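import Summits.HubbardSuperconductivity.HubbardSuperconductivity.Theses.ThermalWedge
import Summits.HubbardSuperconductivity.HubbardSuperconductivity.Theorems.TwTipContinuation.Negative.SeededChords

/-!
# Route `ThermalWedge` — glue item `TwRungGlue` (stmt-HubbardSuperconductivity-1706)

`TwSectorEnergyLowerBound → TwApproximatingHamiltonian → TwSourcedInertness → TwSourcedCondensation →
TwSeededEnsembleEquivalence → TwSeededRung`.

Bookkeeping over the reals plus ONE finite-dimensional fact, the RUNG CHORD `leftChord_le_order`
of `Theorems/TwTipContinuation/Negative/SeededChords.lean`: for a normalised sector ground state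
`ψ` of `H_L(U,g)` and `g' < g`, `E_L(g') − E_L(g) ≤ ((g − g')/L²)·re⟨ψ,P_Lψ⟩`.
Constants (planner's NOTES, θ = 1/4): given `δ` take `(μ₁,μ₂,U₀ᵉ)` from
`TwSeededEnsembleEquivalence`, `(U₀ⁱ,aⁱ,Cᵢ)` and `(U₀ᶜ,aᶜ,c,C_c,h₀)` from the two sourced cruxes
for `[μ₁,μ₂]`; `a := min aⁱ aᶜ`, `x := a/U`, `β := eˣ`, `ε := e⁻ˣ`, probe source `s := e^{-x/4}`,
auxiliary inert seed `g' := 1/(Cᵢ(1+x))`, `K := max (8/(c a)) (2/(Cᵢ a))` (so `K·U > g'` and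
`1/(K U) ≤ c x/8`), `U₀ :=` the minimum of the three input thresholds, `1/(20K)`, `a c/(16(c log 2
+ C_c))`, `a c/(32(log 4 + 2))` and `a h₀/4`.  Then
`e(g') − e(g) ≥ p_L(g) − p_L(g') − log4/β − ε ≥ e^{-x/2}·c x/16 − (log 4 + 2)e^{-x} =: m(U) > 0`
and `⟨ψ,P_Lψ⟩ ≥ L⁴ m/(g − g') ≥ 10 m L⁴`.
-/

namespace Summit.HubbardSuperconductivity.HubbardSuperconductivity.Theorems

open Literature.MathematicalPhysics.QuantumLattice Matrix
open Summit.HubbardSuperconductivity.HubbardSuperconductivity.Theses.ThermalWedge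
open Summit.HubbardSuperconductivity.TwTipContinuation.Negative

/-- The real-arithmetic core of the rung chain: chord + sector lower bound + ensemble equivalence +
approximating Hamiltonian (both halves) + inertness at `g'` + condensation at `g` give
`10·m·L⁴ ≤ ⟨P⟩` once the margin `m ≤ G − s²/g − log4/β − 2ε` is positive. [folklore] -/
theorem twRung_bookkeeping {E' E P pg pg' p₀ ph ph' n n' g g' L β ε Ki lb s h' G m : ℝ}
    (hL : 0 < L) (hgg : g' < g) (hg10 : g - g' ≤ 1 / 10) (hm0 : 0 < m)
    (hchord : E' - E ≤ (g - g') / L ^ 2 * P)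
    (hlow : n - pg' ≤ E' / L ^ 2) (hup : E / L ^ 2 + pg - n' ≤ lb / β + ε) (hn : n = n')
    (hh' : pg' ≤ ph' - h' ^ 2 / g' + ε) (hin : ph' - p₀ ≤ Ki * h' ^ 2)
    (hkey : h' ^ 2 / g' = Ki * h' ^ 2) (heasy : ph - s ^ 2 / g ≤ pg) (hcond : G ≤ ph - p₀)
    (hm : m ≤ G - s ^ 2 / g - lb / β - 2 * ε) :
    10 * m * L ^ 4 ≤ P := by
  subst hn
  have hL2 : 0 < L ^ 2 := by positivity
  have h1 : m ≤ (E' - E) / L ^ 2 := by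
    rw [sub_div]
    linarith
  have h2 : m * L ^ 2 ≤ E' - E := by rwa [le_div_iff₀ hL2] at h1
  have h3 : m * L ^ 2 ≤ (g - g') / L ^ 2 * P := h2.trans hchord
  have hgg' : 0 < g - g' := sub_pos.2 hgg
  have h4 : m * L ^ 4 / (g - g') ≤ P := by
    rw [div_le_iff₀ hgg']
    have e : (g - g') / L ^ 2 * P * L ^ 2 = P * (g - g') := by
      field_simp
    calc m * L ^ 4 = m * L ^ 2 * L ^ 2 := by ring
      _ ≤ (g - g') / L ^ 2 * P * L ^ 2 := mul_le_mul_of_nonneg_right h3 hL2.le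
      _ = P * (g - g') := e
  have h5 : 10 * m * L ^ 4 ≤ m * L ^ 4 / (g - g') := by
    rw [le_div_iff₀ hgg']
    have hmL : 0 ≤ m * L ^ 4 := by positivity
    nlinarith
  exact h5.trans h4

/-- `log(1/(e^{-x/4} + e^{-x})) ≥ x/4 − log 2` for `x > 0` (the Cooper logarithm at the probe
source `s = e^{-x/4}` and temperature `e^{-x}`). [folklore] -/
theorem twRung_log_lower {x : ℝ} (hx : 0 < x) :
    x / 4 - Real.log 2 ≤ Real.log (1 / (|Real.exp (-x / 4)| + 1 / Real.exp x)) := by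
  have h1 : 0 < Real.exp (-x / 4) := Real.exp_pos _
  rw [abs_of_pos h1]
  have hden : 0 < Real.exp (-x / 4) + 1 / Real.exp x := by positivity
  have hle : Real.exp (x / 4) / 2 ≤ 1 / (Real.exp (-x / 4) + 1 / Real.exp x) := by
    rw [div_le_div_iff₀ (by norm_num) hden]
    have e1 : Real.exp (x / 4) * Real.exp (-x / 4) = 1 := by
      rw [← Real.exp_add, show x / 4 + -x / 4 = 0 by ring, Real.exp_zero]
    have e2 : Real.exp (x / 4) * (1 / Real.exp x) = Real.exp (-(3 * x / 4)) := by
      rw [one_div, ← Real.exp_neg, ← Real.exp_add]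
      congr 1
      ring
    have e3 : Real.exp (-(3 * x / 4)) ≤ 1 := Real.exp_le_one_iff.2 (by linarith)
    calc Real.exp (x / 4) * (Real.exp (-x / 4) + 1 / Real.exp x)
        = 1 + Real.exp (-(3 * x / 4)) := by rw [mul_add, e1, e2]
      _ ≤ 1 * 2 := by linarith
  calc x / 4 - Real.log 2 = Real.log (Real.exp (x / 4) / 2) := by
        rw [Real.log_div (Real.exp_pos _).ne' two_ne_zero, Real.log_exp]
    _ ≤ _ := Real.log_le_log (by positivity) hle

/-- The rung margin: with `1/g ≤ c x/8` and `c log 2 + C_c ≤ c x/16`,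
`e^{-x/2} c x/16 − (log 4 + 2)e^{-x} ≤ [c s² log(1/(|s|+1/β)) − C_c s²] − s²/g − log 4/β − 2e^{-x}`
for `s = e^{-x/4}`, `β = eˣ`. [folklore] -/
theorem twRung_margin {x cc Cc g : ℝ} (hx : 0 < x) (hcc : 0 < cc) (hg : 0 < g)
    (hginv : 1 / g ≤ cc * x / 8) (habs : cc * Real.log 2 + Cc ≤ cc * x / 16) :
    Real.exp (-x / 2) * cc * x / 16 - (Real.log 4 + 2) * Real.exp (-x) ≤
      (cc * Real.exp (-x / 4) ^ 2 * Real.log (1 / (|Real.exp (-x / 4)| + 1 / Real.exp x)) -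
          Cc * Real.exp (-x / 4) ^ 2) -
        Real.exp (-x / 4) ^ 2 / g - Real.log 4 / Real.exp x - 2 * Real.exp (-x) := by
  set s := Real.exp (-x / 4) with hsdef
  have hs : 0 < s := Real.exp_pos _
  have hs2 : s ^ 2 = Real.exp (-x / 2) := by
    rw [hsdef, sq, ← Real.exp_add]
    congr 1
    ring
  have hlog : x / 4 - Real.log 2 ≤ Real.log (1 / (|s| + 1 / Real.exp x)) := twRung_log_lower hx
  have h1 : cc * s ^ 2 * (x / 4 - Real.log 2) ≤ cc * s ^ 2 * Real.log (1 / (|s| + 1 / Real.exp x)) :=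
    mul_le_mul_of_nonneg_left hlog (by positivity)
  have h2 : s ^ 2 / g ≤ s ^ 2 * (cc * x / 8) := by
    rw [div_eq_mul_one_div]
    exact mul_le_mul_of_nonneg_left hginv (by positivity)
  have h3 : Real.log 4 / Real.exp x = Real.log 4 * Real.exp (-x) := by
    rw [Real.exp_neg, div_eq_mul_inv]
  have h4 : s ^ 2 * (cc * x / 16) ≤ s ^ 2 * (cc * x / 8 - cc * Real.log 2 - Cc) :=
    mul_le_mul_of_nonneg_left (by linarith) (by positivity)
  have _hg := hg
  rw [h3, ← hs2]
  linarith

/-- The rung margin is positive once `c x/16 ≥ 2(log 4 + 2)`. [folklore] -/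
theorem twRung_margin_pos {x cc : ℝ} (hx : 0 ≤ x) (h : 2 * (Real.log 4 + 2) ≤ cc * x / 16) :
    0 < Real.exp (-x / 2) * cc * x / 16 - (Real.log 4 + 2) * Real.exp (-x) := by
  have h1 : Real.exp (-x) ≤ Real.exp (-x / 2) := Real.exp_le_exp.2 (by linarith)
  have h2 : 0 < Real.exp (-x / 2) := Real.exp_pos _
  have hl : 0 < Real.log 4 + 2 := by
    have := Real.log_pos (by norm_num : (1 : ℝ) < 4)
    linarith
  have A : Real.exp (-x / 2) * (2 * (Real.log 4 + 2)) ≤ Real.exp (-x / 2) * (cc * x / 16) :=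
    mul_le_mul_of_nonneg_left h h2.le
  have B : (Real.log 4 + 2) * Real.exp (-x) ≤ (Real.log 4 + 2) * Real.exp (-x / 2) :=
    mul_le_mul_of_nonneg_left h1 hl.le
  have Cpos : 0 < (Real.log 4 + 2) * Real.exp (-x / 2) := mul_pos hl h2
  linarith

/-- **`TwRungGlue`** (stmt-HubbardSuperconductivity-1706): every-ground-state `d`-wave order of
the seeded model down to seeds `g = K·U` (`TwSeededRung`) follows from the sector energy lower
bound, the approximating-Hamiltonian theorem, sourced inertness, sourced condensation and seeded
ensemble equivalence, by the rung chord `leftChord_le_order` and bookkeeping. -/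
theorem twRungGlue_proof : TwRungGlue := by
  intro hSec hAHM hI hCo hE δ hδ
  obtain ⟨μ₁, μ₂, hμ₁, hμ₁₂, hμ₂, U₀e, hU₀e, hE'⟩ := hE δ hδ
  obtain ⟨U₀i, ai, Ci, hU₀i, hai, hCi, hI'⟩ := hI μ₁ μ₂ hμ₁ hμ₁₂ hμ₂
  obtain ⟨U₀c, ac, cc, Cc, h₀, hU₀c, hac, hcc, hCc, hh₀, hCo'⟩ := hCo μ₁ μ₂ hμ₁ hμ₁₂ hμ₂
  have hlog2 : 0 < Real.log 2 := Real.log_pos (by norm_num)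
  have hlog4 : 0 < Real.log 4 := Real.log_pos (by norm_num)
  set a := min ai ac with hadef
  have ha : 0 < a := lt_min hai hac
  have hane : a ≠ 0 := ha.ne'
  have hccne : cc ≠ 0 := hcc.ne'
  have hCine : Ci ≠ 0 := hCi.ne'
  set K := max (8 / (cc * a)) (2 / (Ci * a)) with hKdef
  have hK : 0 < K := lt_max_of_lt_left (by positivity)
  have hKne : K ≠ 0 := hK.ne'
  have h16 : 0 < cc * Real.log 2 + Cc := by positivity
  have h16ne : cc * Real.log 2 + Cc ≠ 0 := h16.ne'
  have hl42 : 0 < Real.log 4 + 2 := by linarith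
  have hl42ne : Real.log 4 + 2 ≠ 0 := hl42.ne'
  set T₁ := a * cc / (16 * (cc * Real.log 2 + Cc)) with hT₁def
  set T₂ := a * cc / (32 * (Real.log 4 + 2)) with hT₂def
  set T₃ := a * h₀ / 4 with hT₃def
  have hT₁ : 0 < T₁ := by positivity
  have hT₂ : 0 < T₂ := by positivity
  have hT₃ : 0 < T₃ := by positivity
  set U₀ := min (min (min U₀e U₀i) (min U₀c (1 / (20 * K)))) (min (min T₁ T₂) T₃) with hU₀def
  have hU₀ : 0 < U₀ :=
    lt_min (lt_min (lt_min hU₀e hU₀i) (lt_min hU₀c (by positivity))) (lt_min (lt_min hT₁ hT₂) hT₃)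
  refine ⟨U₀, K, hU₀, hK, ?_, ?_⟩
  · have hle : U₀ ≤ 1 / (20 * K) :=
      (min_le_left _ _).trans ((min_le_right _ _).trans (min_le_right _ _))
    calc K * U₀ ≤ K * (1 / (20 * K)) := mul_le_mul_of_nonneg_left hle hK.le
      _ = 1 / 20 := by field_simp
  intro U hU g hg
  obtain ⟨hU0, hUle⟩ := hU
  obtain ⟨hgK, hg10⟩ := hg
  have hUne : U ≠ 0 := hU0.ne'
  have hU1 : U ≤ min (min U₀e U₀i) (min U₀c (1 / (20 * K))) := hUle.trans (min_le_left _ _)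
  have hU2 : U ≤ min (min T₁ T₂) T₃ := hUle.trans (min_le_right _ _)
  have hUe : U ≤ U₀e := hU1.trans ((min_le_left _ _).trans (min_le_left _ _))
  have hUi : U ≤ U₀i := hU1.trans ((min_le_left _ _).trans (min_le_right _ _))
  have hUc : U ≤ U₀c := hU1.trans ((min_le_right _ _).trans (min_le_left _ _))
  have hUT₁ : U ≤ T₁ := hU2.trans ((min_le_left _ _).trans (min_le_left _ _))
  have hUT₂ : U ≤ T₂ := hU2.trans ((min_le_left _ _).trans (min_le_right _ _))
  have hUT₃ : U ≤ T₃ := hU2.trans (min_le_right _ _)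
  have hKU : 0 < K * U := mul_pos hK hU0
  have hgpos : 0 < g := hKU.trans_le hgK
  set x := a / U with hxdef
  have hx : 0 < x := div_pos ha hU0
  set β := Real.exp x with hβdef
  have hβ1 : 1 ≤ β := Real.one_le_exp hx.le
  have hβpos : 0 < β := Real.exp_pos _
  have hlogβ : Real.log β = x := Real.log_exp _
  have hβi : β ≤ Real.exp (ai / U) :=
    Real.exp_le_exp.2 (div_le_div_of_nonneg_right (min_le_left _ _) hU0.le)
  have hβc : β ≤ Real.exp (ac / U) :=
    Real.exp_le_exp.2 (div_le_div_of_nonneg_right (min_le_right _ _) hU0.le)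
  set ε := Real.exp (-x) with hεdef
  have hε : 0 < ε := Real.exp_pos _
  set g' := 1 / (Ci * (1 + x)) with hg'def
  have hg' : 0 < g' := by positivity
  -- `g' < K U ≤ g`
  have hg'U : g' < K * U := by
    have h1 : g' < 1 / (Ci * x) :=
      one_div_lt_one_div_of_lt (by positivity) (mul_lt_mul_of_pos_left (by linarith) hCi)
    have h2 : 1 / (Ci * x) = U / (Ci * a) := by
      simp only [hxdef]
      field_simp
    have h3 : U / (Ci * a) ≤ K * U / 2 := by
      have hK2 : 2 / (Ci * a) ≤ K := le_max_right _ _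
      calc U / (Ci * a) = (U / 2) * (2 / (Ci * a)) := by ring
        _ ≤ (U / 2) * K := mul_le_mul_of_nonneg_left hK2 (by positivity)
        _ = K * U / 2 := by ring
    linarith
  have hg'g : g' < g := hg'U.trans_le hgK
  -- thresholds in `L`
  obtain ⟨μ, hμ, hE''⟩ := hE' U ⟨hU0, hUe⟩ g ⟨hgpos, hg10⟩ β hβ1
  obtain ⟨L₁, hL₁⟩ := hE'' ε hε
  obtain ⟨hEasy, -⟩ := hAHM U μ β g hβpos hgpos
  obtain ⟨-, hHard⟩ := hAHM U μ β g' hβpos hg'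
  obtain ⟨L₂, hL₂⟩ := hHard ε hε
  obtain ⟨L₃, hL₃⟩ := hI' U hU0 hUi β hβ1 hβi μ hμ
  obtain ⟨L₄, hL₄⟩ := hCo' U hU0 hUc β hβ1 hβc μ hμ
  -- the margin
  set m := Real.exp (-x / 2) * cc * x / 16 - (Real.log 4 + 2) * Real.exp (-x) with hmdef
  have habs : cc * Real.log 2 + Cc ≤ cc * x / 16 := by
    have h1 : a / T₁ ≤ x := by
      simp only [hxdef]
      exact div_le_div_of_nonneg_left ha.le hU0 hUT₁
    have h2 : a / T₁ = 16 * (cc * Real.log 2 + Cc) / cc := by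
      simp only [hT₁def]
      field_simp
    have h3 : cc * (a / T₁) / 16 ≤ cc * x / 16 := by gcongr
    have h4 : cc * (a / T₁) / 16 = cc * Real.log 2 + Cc := by
      rw [h2]
      field_simp
    linarith
  have h2l : 2 * (Real.log 4 + 2) ≤ cc * x / 16 := by
    have h1 : a / T₂ ≤ x := by
      simp only [hxdef]
      exact div_le_div_of_nonneg_left ha.le hU0 hUT₂
    have h2 : a / T₂ = 32 * (Real.log 4 + 2) / cc := by
      simp only [hT₂def]
      field_simp
    have h3 : cc * (a / T₂) / 16 ≤ cc * x / 16 := by gcongr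
    have h4 : cc * (a / T₂) / 16 = 2 * (Real.log 4 + 2) := by
      rw [h2]
      field_simp
      ring
    linarith
  have hm0 : 0 < m := twRung_margin_pos hx.le h2l
  refine ⟨10 * m, by positivity, max (max L₁ L₂) (max L₃ L₄), ?_⟩
  intro L _ hL _ ψ hψ hgs
  have hL12 : max L₁ L₂ ≤ L := (le_max_left _ _).trans hL
  have hL34 : max L₃ L₄ ≤ L := (le_max_right _ _).trans hL
  have hL1 : L₁ ≤ L := (le_max_left _ _).trans hL12
  have hL2 : L₂ ≤ L := (le_max_right _ _).trans hL12
  have hL3 : L₃ ≤ L := (le_max_left _ _).trans hL34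
  have hL4 : L₄ ≤ L := (le_max_right _ _).trans hL34
  have hLpos : (0 : ℝ) < (L : ℝ) := by exact_mod_cast NeZero.pos L
  -- the rung chord at `g' < g`
  have hchord := leftChord_le_order hg'g hψ hgs
  -- sector lower bound at `g'` (the sector is inhabited by `ψ`)
  have hV : szSector (Λ := FermionTorus 2 L) (2 * ⌊(1 - δ) * (L : ℝ) ^ 2 / 2⌋₊) 0 ≠ ⊥ :=
    (Submodule.ne_bot_iff _).2 ⟨ψ, hgs.1, hgs.2.1⟩
  have hlow := hSec L (2 * ⌊(1 - δ) * (L : ℝ) ^ 2 / 2⌋₊) U μ β g' hβpos hV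
  -- ensemble equivalence at `g`
  have hup := hL₁ L hL1
  have hn : μ * ((2 * ⌊(1 - δ) * (L : ℝ) ^ 2 / 2⌋₊ : ℕ) : ℝ) / (L : ℝ) ^ 2 =
      μ * ((2 * ⌊(1 - δ) * (L : ℝ) ^ 2 / 2⌋₊) : ℝ) / (L : ℝ) ^ 2 := by
    push_cast; ring
  -- approximating Hamiltonian (hard half) + inertness at `g'`
  obtain ⟨h', hh'⟩ := hL₂ L hL2
  have hin := hL₃ L hL3 h'
  rw [dWaveSourceTorus_zero] at hin
  have hkey : h' ^ 2 / g' = Ci * (1 + Real.log β) * h' ^ 2 := by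
    rw [hlogβ, hg'def, div_div_eq_mul_div, div_one]
    ring
  -- approximating Hamiltonian (easy half) + condensation at `g`, probe source `s = e^{-x/4}`
  set s := Real.exp (-x / 4) with hsdef
  have hs : 0 < s := Real.exp_pos _
  have hsh₀ : |s| ≤ h₀ := by
    rw [abs_of_pos hs]
    have hx4 : 0 < x / 4 := by positivity
    have e1 : s ≤ 4 * U / a := by
      rw [hsdef, show -x / 4 = -(x / 4) by ring, Real.exp_neg]
      calc (Real.exp (x / 4))⁻¹ ≤ (x / 4)⁻¹ :=
            inv_anti₀ hx4 (by linarith [Real.add_one_le_exp (x / 4)])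
        _ = 4 * U / a := by
            simp only [hxdef]
            field_simp
    have e2 : 4 * U / a ≤ h₀ := by
      rw [div_le_iff₀ ha]
      have h3 : U ≤ a * h₀ / 4 := hUT₃
      rw [le_div_iff₀ (by norm_num : (0 : ℝ) < 4)] at h3
      linarith
    exact e1.trans e2
  have heasy := hEasy L s
  have hcond := hL₄ L hL4 s hsh₀
  rw [dWaveSourceTorus_zero] at hcond
  have hginv : 1 / g ≤ cc * x / 8 := by
    have h1 : 1 / g ≤ 1 / (K * U) := one_div_le_one_div_of_le hKU hgK
    have hK1 : 8 / (cc * a) ≤ K := le_max_left _ _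
    have h2 : 1 / (K * U) ≤ 1 / (8 / (cc * a) * U) :=
      one_div_le_one_div_of_le (by positivity) (mul_le_mul_of_nonneg_right hK1 hU0.le)
    have h3 : 1 / (8 / (cc * a) * U) = cc * x / 8 := by
      simp only [hxdef]
      field_simp
    linarith
  have hmargin := twRung_margin (Cc := Cc) hx hcc hgpos hginv habs
  exact twRung_bookkeeping hLpos hg'g (by linarith) hm0 hchord hlow hup hn hh' hin hkey heasy hcond
    hmargin

end Summit.HubbardSuperconductivity.HubbardSuperconductivity.Theorems
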